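import Summits.Ventures.PercRepro.RankLevelSetExplicitLin2KeyL

/-!
# PercRepro — THE LEVEL-13 THEOREM-M ROW OF C-025 (SHARP): THE KEY AT `p = 8 536` (p4, S4 feed)

`proofs/P4-gen18.md`. With THEOREM M's staircase multiplicity the assembled inequality `(P_d)` holds, exactly evaluated, at EVERY
core corank `14 ≤ d ≤ 8205` from `p = 2 992` (it fails at `p = 2 991`, corank `2 582`; the quartic floor is `17 876`, the
saturated one `85 609`). The row is taken at `p = 8 536` = the optimal-Chernoff tail (the least `p` with `16·n^n ≤ 2^n·(n − K)^{n−K}·K^K` at `n = p + D`, `K = 13 + D`, `D = 13 + 2^13`) of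
RankLevelSetExplicitLin2TailOptimal, which now binds: the key `KeyL 13 8536 d` (RankLevelSetExplicitLin2KeyL) is checked by the kernel at the
8 192 coranks (`decide`, 4 chunks of 2 048). The level step and the unconditional chain are
RankLevelSetExplicitLin2IndepFloorS (`c025_thirteen_indepS_step`, `c025_thirteen_indepS_from_8536`). Axioms: standard.
-/

namespace PercRepro

namespace ThmN

namespace Explicit

/-- The THEOREM-M key row at `(q, p) = (13, 8 536)`, chunk 1 of 4: coranks `14 … 2061`, by the kernel. -/
theorem key_thirteen_indepS_row_1 : ∀ t < 2048, KeyL 13 8536 (14 + t) := by decide +kernel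

/-- The THEOREM-M key row at `(q, p) = (13, 8 536)`, chunk 2 of 4: coranks `2062 … 4109`, by the kernel. -/
theorem key_thirteen_indepS_row_2 : ∀ t < 2048, KeyL 13 8536 (14 + (2048 + t)) := by decide +kernel

/-- The THEOREM-M key row at `(q, p) = (13, 8 536)`, chunk 3 of 4: coranks `4110 … 6157`, by the kernel. -/
theorem key_thirteen_indepS_row_3 : ∀ t < 2048, KeyL 13 8536 (14 + (4096 + t)) := by decide +kernel

/-- The THEOREM-M key row at `(q, p) = (13, 8 536)`, chunk 4 of 4: coranks `6158 … 8205`, by the kernel. -/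
theorem key_thirteen_indepS_row_4 : ∀ t < 2048, KeyL 13 8536 (14 + (6144 + t)) := by decide +kernel

/-- **THE THEOREM-M KEY ROW AT `(q, p) = (13, 8 536)`**: `KeyL 13 8536 d` at every corank `14 ≤ d ≤ 8205` (the 4 chunks). -/
theorem key_thirteen_indepS_row : ∀ t < 8192, KeyL 13 8536 (14 + t) :=
  ball_lt_add (fun t => KeyL 13 8536 (14 + t)) 6144 2048
    (ball_lt_add (fun t => KeyL 13 8536 (14 + t)) 4096 2048
    (ball_lt_add (fun t => KeyL 13 8536 (14 + t)) 2048 2048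
    (key_thirteen_indepS_row_1) key_thirteen_indepS_row_2) key_thirteen_indepS_row_3) key_thirteen_indepS_row_4

end Explicit

end ThmN

end PercRepro
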